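import Literature.Claims.NS.Gnayoro2026
import Mathlib.MeasureTheory.Measure.Lebesgue.VolumeOfBalls
import Mathlib.Analysis.Real.Pi.Bounds
import HarnessLib

/-!
# C139 `Gnayoro2026`: the printed cut-off class is empty, and the explicit datum (2.3) is not
# divergence free — `¬ Step0_cutoff`, `¬ Step1_data`, `¬ ClaimedTheoremExplicit`

Refutation kit of record for row C139 of the D-0090 «where NS proofs break» map (text of record: Zenodo
record 22117097, PDF sha16 ac22e07702876186, 9 pp., PDF page = printed page; skeleton
`Literature/Claims/NS/Gnayoro2026.lean`, ns-claims-typist-12 g5, p518976 @ 727249967f4d).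

* `not_Step1_data : ¬ Literature.Claims.NS.Gnayoro2026.Step1_data` — **the token.** Prop 2.2 (1) p.3 l.8
  («u₀ ∈ C∞_σ(𝕋³) and ∇ ⋅ u₀ = 0» for the datum (2.3)) over the USED cut-off class `IsCutoff₀` and the
  printed background class `IsBackground` is false, and the countermodel is the datum itself: take the
  file's own members `exists_cutoff₀` (a smooth bump `χ`, `= 1` on `‖y‖ < ρ/2`) and `isBackground_zero`
  (`u_bg = 0`). Near `x₀` the datum is literally `A χ(x−x₀) e^{−|x−x₀|²/ρ²} e_z` (`datum_eq_formula`), and on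
  `B(x₀, ρ/2)` the cut-off is `≡ 1`, so at `x⋆ = x₀ + (ρ/4) e_z`
  `∇·u₀(x⋆) = ∂₃[A e^{−|y|²/ρ²}](0,0,ρ/4) = −(A/(2ρ)) e^{−1/16} ≈ −4.70·10⁶ ≠ 0` (`A = 10⁵`, `ρ = 10⁻²`).
  Only «χ ≡ 1 on B(0,ρ/2)», `u_bg` differentiable with `∇·u_bg(x⋆) = 0`, `A ≠ 0`, `ρ ≠ 0` are used
  (`trace_fderiv_datum_ne_zero`), so the same computation refutes the divergence clause for EVERY
  admissible pair `(χ, u_bg)`, not only the exhibited one (`not_isDivFree_datum`).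
* `not_Step0_cutoff : ¬ Literature.Claims.NS.Gnayoro2026.Step0_cutoff` — the VERBATIM cut-off sentence
  §2.3 p.2 l.26–27 («0 ≤ χ ≤ 1, supp χ ⊂ B(0,ρ), ∫χ = 1», `ρ = 0.01`) has no instance:
  `∫χ ≤ |B(0,ρ)| = (4π/3)·10⁻⁶ < 1` (`integral_le_volume_ball`, Mathlib
  `EuclideanSpace.volume_ball_fin_three`, `Real.pi_lt_four`); whence, by the skeleton's own
  `not_explicit_of_not_step0`, `not_ClaimedTheoremExplicit : ¬ ClaimedTheoremExplicit` (Theorem 1.1 in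
  its verbatim «defined explicitly in (2.3)» face has no witness) — the vacuity reading of the literal
  text, recorded alongside the token (the composition `delivered_of_steps` consumes `Step1_data`, not
  `Step0_cutoff`).
Kill route (README): 3 — explicit countermodel (the datum itself) for the token; 5 — vacuity for the
companion. Class reading for the row: false lemma (countermodel), on the used class `IsCutoff₀` = REF
ns-claims-ref-3 g5's charitable re-typing R1 (RETYPE.md 44c3b25ea7fd38f9: drop «∫χ = 1»).
Author: ns-claims-refuter-8 g4 (refuter of record; PREDICTED-R seal 2128e531e0c3b898).
WHAT THIS IS NOT: not a claim about NS regularity or blow-up; not a claim about any author beyond the typed locator.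
-/

noncomputable section
set_option linter.dupNamespace false

open Set MeasureTheory Metric Filter Topology
open scoped ContDiff RealInnerProductSpace

namespace Summit.NavierStokesRegularity.NavierStokesRegularity.Theorems.Gnayoro2026
open Literature.Claims.NS.Gnayoro2026
open Literature.Analysis Literature.Analysis.FluidPDE

/-! ## 1. The verbatim cut-off class is empty (`¬ Step0_cutoff`) -/

/-- A `[0,1]`-valued function on `ℝ³` vanishing off `B(0,r)` has `∫χ ≤ |B(0,r)| = (4π/3) r³`. -/
theorem integral_le_volume_ball {χ : E3 → ℝ} {r : ℝ} (hr : 0 ≤ r)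
    (h0 : ∀ x, 0 ≤ χ x) (h1 : ∀ x, χ x ≤ 1) (hsupp : ∀ x, x ∉ ball (0 : E3) r → χ x = 0) :
    ∫ x, χ x ≤ r ^ 3 * (Real.pi * 4 / 3) := by
  have hball : volume.real (ball (0 : E3) r) = r ^ 3 * (Real.pi * 4 / 3) := by
    rw [Measure.real, EuclideanSpace.volume_ball_fin_three, ENNReal.toReal_mul, ENNReal.toReal_pow,
      ENNReal.toReal_ofReal hr, ENNReal.toReal_ofReal (by positivity : (0 : ℝ) ≤ Real.pi * 4 / 3)]
  calc ∫ x, χ x ≤ ∫ x, (ball (0 : E3) r).indicator (1 : E3 → ℝ) x := by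
        refine integral_mono_of_nonneg (Eventually.of_forall h0) ?_
          (Eventually.of_forall fun x => ?_)
        · exact (integrable_indicator_iff measurableSet_ball).2
            (integrableOn_const (measure_ball_lt_top).ne)
        · by_cases hx : x ∈ ball (0 : E3) r
          · simpa [Set.indicator_of_mem hx] using h1 x
          · simp [Set.indicator_of_notMem hx, hsupp x hx]
    _ = volume.real (ball (0 : E3) r) := integral_indicator_one measurableSet_ball
    _ = r ^ 3 * (Real.pi * 4 / 3) := hball

/-- **¬ Step 0** [§2.3 p.2 l.26–27]: no `χ` with `0 ≤ χ ≤ 1`, `χ = 0` off `B(0, 1/100)` and `∫χ = 1`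
exists (`∫χ ≤ 4π·10⁻⁶/3 < 1`). -/
theorem not_Step0_cutoff : ¬ Step0_cutoff := by
  rintro ⟨χ, _, _, h01, _, hoff, hint⟩
  have hsupp : ∀ x, x ∉ ball (0 : E3) rho → χ x = 0 := by
    intro x hx
    rw [mem_ball, dist_zero_right, not_lt] at hx
    exact hoff x hx
  have h := integral_le_volume_ball (by unfold rho; norm_num) (fun x => (h01 x).1)
    (fun x => (h01 x).2) hsupp
  rw [hint] at h
  unfold rho at h
  have hπ := Real.pi_lt_four
  nlinarith

/-- **¬ (Theorem 1.1, verbatim face)**: «u₀ defined explicitly in (2.3)» quantifies over the empty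
cut-off class, so `ClaimedTheoremExplicit` has no witness (the skeleton's `not_explicit_of_not_step0`). -/
theorem not_ClaimedTheoremExplicit : ¬ ClaimedTheoremExplicit :=
  not_explicit_of_not_step0 not_Step0_cutoff

/-! ## 2. The datum (2.3) is not divergence free (`¬ Step1_data`) -/

/-- The scalar amplitude `g(y) = A exp(−|y − x₀|²/ρ²)` of (2.3) (cut-off removed), generic in `A, ρ, x₀`. -/
def gaussAmp (A r : ℝ) (x₀ : E3) (y : E3) : ℝ := A * Real.exp (-(‖y - x₀‖ ^ 2) / r ^ 2)

/-- `Dg(y) = A e^{−|y−x₀|²/ρ²} · (−ρ⁻²) · 2⟨y − x₀, ·⟩`. -/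
theorem hasFDerivAt_gaussAmp (A r : ℝ) (x₀ y : E3) :
    HasFDerivAt (gaussAmp A r x₀)
      (A • Real.exp (-(‖y - x₀‖ ^ 2) / r ^ 2) • ((-(1 : ℝ) / r ^ 2) • (2 • innerSL ℝ (y - x₀)))) y := by
  have h1 : HasFDerivAt (fun y : E3 => ‖y - x₀‖ ^ 2) (2 • innerSL ℝ (y - x₀)) y := by
    simpa using ((hasFDerivAt_id y).sub_const x₀).norm_sq
  have h2 : HasFDerivAt (fun y : E3 => -(‖y - x₀‖ ^ 2) / r ^ 2)
      ((-(1 : ℝ) / r ^ 2) • (2 • innerSL ℝ (y - x₀))) y := by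
    refine (h1.const_mul (-(1 : ℝ) / r ^ 2)).congr_of_eventuallyEq ?_
    exact Eventually.of_forall fun z => by simp only; ring
  exact h2.exp.const_mul A

/-- `Dg(y) h = A e^{−|y−x₀|²/ρ²} · (−2/ρ²) ⟨y − x₀, h⟩`. -/
theorem fderiv_gaussAmp_apply (A r : ℝ) (x₀ y h : E3) :
    fderiv ℝ (gaussAmp A r x₀) y h =
      A * Real.exp (-(‖y - x₀‖ ^ 2) / r ^ 2) * (-(2 : ℝ) / r ^ 2 * ⟪y - x₀, h⟫) := by
  rw [(hasFDerivAt_gaussAmp A r x₀ y).fderiv]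
  simp [innerSL_apply_apply, smul_eq_mul, inner_sub_left]
  ring

/-- **Divergence of `(χ'·g) e_z + u_bg` where `χ' ≡ 1` nearby and `∇·u_bg = 0`:**
`tr D[(χ' g) e_z + u_bg](y) = ∂₃ g(y) = A e^{−|y−x₀|²/ρ²} (−2/ρ²) (y − x₀)₃`. -/
theorem trace_fderiv_datum (A r : ℝ) (x₀ y : E3) (χ' : E3 → ℝ) (ubg : E3 → E3)
    (hχ : ∀ᶠ x in 𝓝 y, χ' x = 1) (hbg : DifferentiableAt ℝ ubg y)
    (hbg0 : LinearMap.trace ℝ E3 (fderiv ℝ ubg y : E3 →ₗ[ℝ] E3) = 0) :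
    LinearMap.trace ℝ E3
        (fderiv ℝ (fun x => (χ' x * gaussAmp A r x₀ x) • ez + ubg x) y : E3 →ₗ[ℝ] E3) =
      A * Real.exp (-(‖y - x₀‖ ^ 2) / r ^ 2) * (-(2 : ℝ) / r ^ 2 * (y - x₀) 2) := by
  have hev : (fun x => (χ' x * gaussAmp A r x₀ x) • ez + ubg x) =ᶠ[𝓝 y]
      (fun x => (gaussAmp A r x₀ x) • ez + ubg x) := by
    filter_upwards [hχ] with x hx
    simp [hx]
  rw [hev.fderiv_eq]
  have hF : HasFDerivAt (fun x => (gaussAmp A r x₀ x) • ez)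
      ((fderiv ℝ (gaussAmp A r x₀) y).smulRight ez) y :=
    (hasFDerivAt_gaussAmp A r x₀ y).differentiableAt.hasFDerivAt.smul_const ez
  have hsum : HasFDerivAt (fun x => (gaussAmp A r x₀ x) • ez + ubg x)
      ((fderiv ℝ (gaussAmp A r x₀) y).smulRight ez + fderiv ℝ ubg y) y :=
    hF.add hbg.hasFDerivAt
  rw [hsum.fderiv, ContinuousLinearMap.toLinearMap_add, map_add, hbg0, add_zero,
    LinearMap.trace_eq_sum_inner _ (EuclideanSpace.basisFun (Fin 3) ℝ)]
  simp [fderiv_gaussAmp_apply, ez, EuclideanSpace.inner_single_left, EuclideanSpace.inner_single_right]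

/-- **… at `y = x₀ + (ρ/4) e_z` the divergence is `−(A/(2ρ)) e^{−1/16} ≠ 0`** (`A ≠ 0`, `ρ ≠ 0`). -/
theorem trace_fderiv_datum_ne_zero (A r : ℝ) (hA : A ≠ 0) (hr : r ≠ 0) (x₀ : E3)
    (χ' : E3 → ℝ) (ubg : E3 → E3)
    (hχ : ∀ᶠ x in 𝓝 (x₀ + (r / 4) • ez), χ' x = 1)
    (hbg : DifferentiableAt ℝ ubg (x₀ + (r / 4) • ez))
    (hbg0 : LinearMap.trace ℝ E3 (fderiv ℝ ubg (x₀ + (r / 4) • ez) : E3 →ₗ[ℝ] E3) = 0) :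
    LinearMap.trace ℝ E3
        (fderiv ℝ (fun x => (χ' x * gaussAmp A r x₀ x) • ez + ubg x) (x₀ + (r / 4) • ez) :
          E3 →ₗ[ℝ] E3) ≠ 0 := by
  rw [trace_fderiv_datum A r x₀ _ χ' ubg hχ hbg hbg0]
  have hez : ‖ez‖ = 1 := by simp [ez]
  have hn : ‖(x₀ + (r / 4) • ez) - x₀‖ ^ 2 = r ^ 2 / 16 := by
    rw [add_sub_cancel_left, norm_smul, hez, Real.norm_eq_abs, mul_one, sq_abs]
    ring
  have hi : ((x₀ + (r / 4) • ez) - x₀) 2 = r / 4 := by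
    rw [add_sub_cancel_left]
    simp [ez]
  rw [hn, hi]
  have h16 : -(r ^ 2 / 16) / r ^ 2 = -(1 : ℝ) / 16 := by field_simp
  rw [h16]
  have hexp : Real.exp (-(1 : ℝ) / 16) ≠ 0 := Real.exp_ne_zero _
  have h4 : r / 4 ≠ 0 := div_ne_zero hr four_ne_zero
  have h2 : -(2 : ℝ) / r ^ 2 ≠ 0 := div_ne_zero (by norm_num) (pow_ne_zero 2 hr)
  exact mul_ne_zero (mul_ne_zero hA hexp) (mul_ne_zero h2 h4)

/-- The evaluation point `x⋆ = x₀ + (ρ/4) e_z`. -/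
def xstar : E3 := ctr + (rho / 4) • ez

/-- `x⋆` lies in the open period cell centred at `x₀` (indeed `|x⋆ᵢ − x₀ᵢ| ≤ ρ/4 < π`), so the datum
is literally (2.3) near `x⋆`. -/
theorem datum_eventuallyEq_formula (χ : E3 → ℝ) (ub : E3 → E3) :
    datum χ ub =ᶠ[𝓝 xstar] formula χ ub := by
  have hopen : IsOpen {x : E3 | ∀ i, x i ∈ Ioo (ctr i - Real.pi) (ctr i + Real.pi)} := by
    have : {x : E3 | ∀ i, x i ∈ Ioo (ctr i - Real.pi) (ctr i + Real.pi)} =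
        ⋂ i, (fun x : E3 => x i) ⁻¹' Ioo (ctr i - Real.pi) (ctr i + Real.pi) := by
      ext x; simp
    rw [this]
    exact isOpen_iInter_of_finite fun i => (PiLp.continuous_apply 2 _ i).isOpen_preimage _ isOpen_Ioo
  have hρπ : rho / 4 < Real.pi := by
    have := Real.pi_gt_three
    unfold rho; linarith
  have hmem : xstar ∈ {x : E3 | ∀ i, x i ∈ Ioo (ctr i - Real.pi) (ctr i + Real.pi)} := by
    intro i
    have hx : xstar i = ctr i + (rho / 4) * ez i := by simp [xstar]
    rw [hx]
    fin_cases i <;> simp [ez] <;> (try constructor) <;> nlinarith [Real.pi_pos, hρπ, show (0:ℝ) < rho by unfold rho; norm_num]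
  filter_upwards [hopen.mem_nhds hmem] with x hx
  exact datum_eq_formula fun i => Ioo_subset_Ico_self (hx i)

/-- (2.3) in the shape of `trace_fderiv_datum`: `formula χ u_bg = (χ(·−x₀) · g) e_z + u_bg` with
`g = gaussAmp A ρ x₀`. -/
theorem formula_eq (χ : E3 → ℝ) (ub : E3 → E3) :
    formula χ ub = fun x => ((fun x => χ (x - ctr)) x * gaussAmp amp rho ctr x) • ez + ub x := by
  funext x
  simp only [formula, jet, gauss, gaussAmp, neg_div]
  congr 1
  ring

/-- **The divergence clause of Prop 2.2 (1) fails for EVERY admissible pair**: for any `χ` with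
`χ = 1` on `‖y‖ < ρ/2` and any differentiable `u_bg` with `∇·u_bg = 0`, `∇·(datum χ u_bg)(x⋆) ≠ 0`. -/
theorem not_isDivFree_datum {χ : E3 → ℝ} {ub : E3 → E3} (hχ : ∀ y : E3, ‖y‖ < rho / 2 → χ y = 1)
    (hubd : Differentiable ℝ ub) (hub0 : NSWave0.IsDivFree ub) :
    ¬ NSWave0.IsDivFree (datum χ ub) := by
  intro hdiv
  have hρ : (0 : ℝ) < rho := by unfold rho; norm_num
  have h0 := hdiv xstar
  rw [NSWave0.divergence, (datum_eventuallyEq_formula χ ub).fderiv_eq, formula_eq] at h0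
  -- the cut-off is ≡ 1 near x⋆
  have hχ' : ∀ᶠ x in 𝓝 (ctr + (rho / 4) • ez), (fun x => χ (x - ctr)) x = 1 := by
    have hez : ‖ez‖ = 1 := by simp [ez]
    have hmem : ctr + (rho / 4) • ez ∈ ball ctr (rho / 2) := by
      rw [mem_ball, dist_eq_norm, add_sub_cancel_left, norm_smul, hez, mul_one,
        Real.norm_eq_abs, abs_of_pos (by positivity)]
      linarith
    filter_upwards [isOpen_ball.mem_nhds hmem] with x hx
    rw [mem_ball, dist_eq_norm] at hx
    exact hχ (x - ctr) hx
  have hA : amp ≠ 0 := by unfold amp; norm_num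
  exact trace_fderiv_datum_ne_zero amp rho hA hρ.ne' ctr (fun x => χ (x - ctr)) ub hχ'
    (hubd _) (hub0 _) h0

/-- **¬ Step 1** [Prop 2.2 (1) p.3 l.8] — the token: with the skeleton's own members `exists_cutoff₀`
and `isBackground_zero`, `∇·u₀(x₀ + (ρ/4)e_z) = −(A/(2ρ))e^{−1/16} ≠ 0`. -/
theorem not_Step1_data : ¬ Step1_data := by
  intro h
  obtain ⟨χ, hχ⟩ := exists_cutoff₀
  have h1 := (h χ 0 hχ isBackground_zero).2
  exact not_isDivFree_datum hχ.2.2.1 (differentiable_const (0 : E3)) isBackground_zero.2.1 h1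

end Summit.NavierStokesRegularity.NavierStokesRegularity.Theorems.Gnayoro2026

end
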